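import Summits.FinalStateConjecture.FinalStateConjecture.Theorems.PhotonSphereChannelsChannelsResolveTameDevelopmentsRSubspacetimeSilenceTransport
import Summits.FinalStateConjecture.FinalStateConjecture.Theorems.PhotonSphereChannelsChannelsResolveTameDevelopmentsRHullTrimming
import HarnessLib

/-!
# Route PhotonSphereChannels · crux `ChannelsResolveTameDevelopmentsR` (K2R-T2, stmt-FinalStateConjecture-17430) ·
# line `tame-lasalle-dock` · stub D `stub_dockReadyHull`: the TYPED REDUCTION to three causal inputs
# (asymptotic inertiality of flat elements, a globally hyperbolic collar neighbourhood of the d.o.c., global hyperbolicity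
# + completeness of FULL elements)

Stub D (`stub_dockReadyHull`, Reshape 1/1c of lead c8) asks, for every silent hull element `(𝓢, E, p)` of a development as in Φ
(outer element along a future-escaping sequence, or horizon-hull element along a generator path): (G6) `IsMinkowski 𝓢 → E.horizon = ∅`,
and (case B) `𝓢` globally hyperbolic and timelike/null complete OR (case A) a REPRESENTATIVE `(𝓢', E', Λ', r₀', j)`: an end in an
all-orders class, non-radiating, `𝓢'` globally hyperbolic and black-hole-or-complete, `j` an injective local isometry with
`j '' E'.doc = E.doc` and `IsMinkowski 𝓢' → IsMinkowski 𝓢`. This file proves D's text VERBATIM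
(`dockReadyHull_of_inertial_of_collar_of_full`, registered sub-goal) from three ∀-inputs over the same elements, isolating exactly
what is not in the tree:

* (I) ASYMPTOTIC INERTIALITY, strengthened G6: `IsMinkowski 𝓢 → 𝓢.blackHoleRegionOfEnd (range E.far) = ∅` (a flat spacetime has no
  black-hole region w.r.t. an eternal tame far chart; implies G6 since `𝓔⁺ ⊆ B`);
* (C) COLLAR: if `E.doc ≠ univ`, an open connected `U ∋ p` containing `E.doc ∪ range E.far ∪ E.horizon` and, for every order `k`, a
  clock-adapted centred tame ball of `E` at every point of `E.doc`, such that `𝓢|_U` is globally hyperbolic with NONEMPTY black-hole region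
  w.r.t. the far cylinder (for elements with `E.horizon ≠ ∅` nonemptiness is automatic from `E.horizon ⊆ U`,
  `blackHoleRegionOfEnd_restrict_nonempty_of_mem_horizon`; for white-hole-type elements it is part of the input);
* (F) FULL ELEMENTS: if `E.doc = univ` (no black hole, no white hole: then case A forces `j` onto, so A ⟺ B), `𝓢` is globally
  hyperbolic and timelike- and null-geodesically complete.

Assembly: G6 from (I); `E.doc = univ` ⇒ case B by (F); otherwise case A with `𝓢' := 𝓢|_U`, `E'` := the transported end
(`isTameClass_transport`, `isSilent_transport`), `j := Subtype.val` (`isLocalIsometry_subtypeVal_restrict`), `j '' E'.doc = E.doc`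
(`image_val_docOfEnd_restrict`), black hole from (C); and `IsMinkowski 𝓢|_U → IsMinkowski 𝓢` holds VACUOUSLY: the trimmed
`(𝓢|_U, E', ⟨p, _⟩)` is again a silent hull element of `𝒟` along the same data (no covering clause, `SubconvergesLocallyTo.restrict'`;
`IsSilentHullElement.trim_transport`, `IsHorizonHullElementAlong.trim`), so (I) gives it empty black-hole region, contradicting (C).
No route item is restated; SEK/the transfer are not used here.

References: Wald 1984, §12.1 [Wald1984]; Hawking–Ellis 1973, §6.6 [HawkingEllis1973]; Petersen 2006, Ch. 10 §3.2 [Petersen2006];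
Anderson 2004, Def. 1.1 [Anderson2004].
-/

noncomputable section

set_option maxSynthPendingDepth 3
set_option linter.dupNamespace false

open Set Filter Function TopologicalSpace Manifold Bundle
open scoped Topology Manifold ContDiff ENNReal NNReal

namespace Summit.FinalStateConjecture.FinalStateConjecture.Theorems.TameLaSalle

open Literature.Geometry.Lorentzian
open Summit.FinalStateConjecture.FinalStateConjecture.Theorems.TameHull
open Summit.FinalStateConjecture.FinalStateConjecture.Theorems.DarkFuture

variable {X : Type} [TopologicalSpace X] [ChartedSpace E3 X] [IsManifold (𝓡 3) ∞ X]
  [T2Space X] [SecondCountableTopology X] [ConnectedSpace X] {D : InitialDataSet (𝓡 3) X}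

omit [T2Space X] [SecondCountableTopology X] in
/-- **Trimming an outer silent hull element to a sub-spacetime carrying the transported end.** If `(𝓢, E, p)` is a silent hull
element of `𝒟` along `q` and `U ∋ p` is a connected open set containing `E.doc ∪ range E.far ∪ E.horizon` and clock-adapted tame balls
of every order, then `(𝓢|_U, E↾, ⟨p, _⟩)` — `E↾` the transported end — is a silent hull element of `𝒟` along the SAME `q`, in the same
class: the class and silence transport (`isTameClass_transport`, `isSilent_transport`), `⟨p, _⟩ ∈ closure E↾.doc = closure ι⁻¹ E.doc`
(`ι` is open), and the pointed `C²_loc` subconvergence passes to the sub-spacetime because the tree's notion has no covering clause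
(`SubconvergesLocallyTo.restrict'`). [cite: Petersen2006, Ch. 10 §3.2] -/
theorem _root_.Summit.FinalStateConjecture.FinalStateConjecture.Theorems.TameHull.IsSilentHullElement.trim_transport
    {𝒟 : VacuumCauchyDevelopment D} [𝒟.metric.HasLeviCivita]
    {Λ : ℕ → ℝ≥0} {r₀ : ℝ} {q : ℕ → 𝒟.carrier} {𝓢 : Spacetime.{0} 4} {E : EndDatum 𝓢} {p : 𝓢.carrier}
    (h : IsSilentHullElement 𝒟 Λ r₀ q 𝓢 E p) {U : Opens 𝓢.carrier} (hU : IsConnected (U : Set 𝓢.carrier)) (hp : p ∈ U)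
    (hfar : ∀ x, E.far x ∈ U) (hdoc : E.doc ⊆ U) (hhor : E.horizon ⊆ U)
    (hballs : ∀ (k : ℕ), ∀ q ∈ E.doc, let V : Opens E4 := ⟨Metric.ball (0 : E4) r₀, Metric.isOpen_ball⟩
      ∃ Ψ : V → 𝓢.carrier, 𝓢.IsLateChart (Minkowski.backgroundOn V) Set.univ (-r₀) Ψ ∧
        (∃ x : V, (x : E4) = 0 ∧ Ψ x = q) ∧
        supCkENorm (V : Set E4) k (𝓢.deviationExtend (Minkowski.backgroundOn V) Ψ) ≤ (Λ k : ℝ≥0∞) ∧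
        supCkENorm (V : Set E4) 0 (𝓢.deviationExtend (Minkowski.backgroundOn V) Ψ) ≤ 1 / 2 ∧
        (∀ x : V, 𝓢.timeOrientation.IsFutureDirected (mfderiv 𝓘(ℝ, E4) (𝓡 4) Ψ x (E4.basisVector 0))) ∧
        (∀ x : V, E.clock (Ψ x) = (x : E4) 0 + E.clock q) ∧ ∀ x : V, Ψ x ∈ U) :
    IsSilentHullElement 𝒟 Λ r₀ q
      (𝓢.restrict PseudoRiemannianMetric.contMDiff_restrict_holds 𝓢.timeOrientation.contMDiff_restrict_holds U hU)
      (⟨E.M, E.R, E.C, fun x ↦ (⟨E.far x, hfar x⟩ : U), fun y : U ↦ E.clock y.1⟩ : EndDatum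
        (𝓢.restrict PseudoRiemannianMetric.contMDiff_restrict_holds 𝓢.timeOrientation.contMDiff_restrict_holds U hU))
      (Subtype.mk p hp) := by
  obtain ⟨hq, hcls, hsil, hclos, hconv⟩ := h
  refine ⟨hq, isTameClass_transport hU E hfar hdoc hcls hballs,
    isSilent_transport hU E hfar hdoc hhor hcls.isTameEnd.clock_smooth hsil, ?_, hconv.restrict' U hU hp⟩
  rw [doc_transport hU E hfar hdoc]
  have hval : IsOpenMap (Subtype.val : U → 𝓢.carrier) := U.isOpen.isOpenMap_subtype_val
  have h2 := hval.preimage_closure_eq_closure_preimage continuous_subtype_val E.doc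
  have h1 : (⟨p, hp⟩ : U) ∈ (Subtype.val : U → 𝓢.carrier) ⁻¹' closure E.doc := hclos
  rw [h2] at h1
  exact h1

/-- **The typed reduction of stub D (registered sub-goal `dockReadyHull_of_inertial_of_collar_of_full` of
stmt-FinalStateConjecture-17430).** Conclusion: the text of `stub_dockReadyHull` VERBATIM. Hypothesis: ONE ∀ over the same silent hull
elements of developments as in Φ of the conjunction of (I) asymptotic inertiality `IsMinkowski 𝓢 → 𝓢.blackHoleRegionOfEnd (range E.far) = ∅`;
(C) for `E.doc ≠ univ`, a connected open `U ∋ p` with `E.doc ∪ range E.far ∪ E.horizon ⊆ U`, clock-adapted tame balls of every order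
inside `U`, `𝓢|_U` globally hyperbolic with nonempty black-hole region w.r.t. the far cylinder; (F) for `E.doc = univ`, `𝓢` globally
hyperbolic and timelike- and null-geodesically complete. See the module docstring for the assembly. [cite: Wald1984, §12.1] -/
theorem dockReadyHull_of_inertial_of_collar_of_full : (∀ (X : Type) [TopologicalSpace X] [ChartedSpace E3 X] [IsManifold (𝓡 3) ∞ X] [T2Space X] [SecondCountableTopology X] [ConnectedSpace X], ∀ D ∈ admissibleVacuumData X, ∀ (𝒟 : VacuumCauchyDevelopment D) [𝒟.metric.HasLeviCivita], DevHyp 𝒟 → ∀ (Λ : ℕ → ℝ≥0) (r₀ : ℝ) (𝓢 : Spacetime.{0} 4) (E : EndDatum 𝓢) (p : 𝓢.carrier), ((∃ q : ℕ → 𝒟.carrier, IsSilentHullElement 𝒟 Λ r₀ q 𝓢 E p) ∨ (∃ (γ : ℝ → 𝒟.carrier) (s : ℕ → ℝ), IsHorizonPath 𝒟 γ ∧ Tendsto s atTop atTop ∧ IsHorizonHullElementAlong 𝒟 Λ r₀ γ s 𝓢 E p)) → (IsMinkowski 𝓢 → 𝓢.blackHoleRegionOfEnd (Set.range E.far) =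 ∅) ∧ (E.doc ≠ Set.univ → ∃ (U : Opens 𝓢.carrier) (hU : IsConnected (U : Set 𝓢.carrier)), p ∈ U ∧ E.doc ⊆ U ∧ (∀ x, E.far x ∈ U) ∧ E.horizon ⊆ U ∧ (∀ (k : ℕ), ∀ q ∈ E.doc, let V : Opens E4 := ⟨Metric.ball (0 : E4) r₀, Metric.isOpen_ball⟩; ∃ Ψ : V → 𝓢.carrier, 𝓢.IsLateChart (Minkowski.backgroundOn V) Set.univ (-r₀) Ψ ∧ (∃ x : V, (x : E4) = 0 ∧ Ψ x = q) ∧ supCkENorm (V : Set E4) k (𝓢.deviationExtend (Minkowski.backgroundOn V) Ψ) ≤ (Λ k : ℝ≥0∞) ∧ supCkENorm (V : Set E4) 0 (𝓢.deviationExtend (Minkowski.backgroundOn V) Ψ) ≤ 1 / 2 ∧ (∀ x : V, 𝓢.timeOrientation.IsFutureDirected (mfderiv 𝓘(ℝ, E4) (𝓡 4) Ψ x (E4.basisVector 0))) ∧ (∀ x : V, E.clock (Ψ x) = (x : E4) 0 + E.clock q) ∧ ∀ x : V, Ψ x ∈ U) ∧ ∀ [(𝓢.restrict PseudoRiemannianMetric.contMDiff_restrict_holds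 𝓢.timeOrientation.contMDiff_restrict_holds U hU).metric.HasLeviCivita], (𝓢.restrict PseudoRiemannianMetric.contMDiff_restrict_holds 𝓢.timeOrientation.contMDiff_restrict_holds U hU).metric.IsGloballyHyperbolic (𝓢.restrict PseudoRiemannianMetric.contMDiff_restrict_holds 𝓢.timeOrientation.contMDiff_restrict_holds U hU).timeOrientation ∧ ((𝓢.restrict PseudoRiemannianMetric.contMDiff_restrict_holds 𝓢.timeOrientation.contMDiff_restrict_holds U hU).blackHoleRegionOfEnd (Subtype.val ⁻¹' Set.range E.far)).Nonempty) ∧ (E.doc = Set.univ → ∀ [𝓢.metric.HasLeviCivita], 𝓢.metric.IsGloballyHyperbolic 𝓢.timeOrientation ∧ 𝓢.metric.IsTimelikeGeodesicallyComplete ∧ 𝓢.metric.IsNullGeodesicallyComplete)) → ∀ (X : Type) [TopologicalSpace X] [ChartedSpace E3 X] [IsManifold (𝓡 3) ∞ X] [T2Space X] [SecondCountableTopology X] [ConnectedSpace X], ∀ D ∈ admissibleVacuumData X, ∀ (𝒟 : VacuumCauchyDevelopment D) [𝒟.metric.HasLeviCivita], DevHyp 𝒟 → ∀ (Λ : ℕ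 → ℝ≥0) (r₀ : ℝ) (𝓢 : Spacetime.{0} 4) (E : EndDatum 𝓢) (p : 𝓢.carrier), ((∃ q : ℕ → 𝒟.carrier, IsSilentHullElement 𝒟 Λ r₀ q 𝓢 E p) ∨ (∃ (γ : ℝ → 𝒟.carrier) (s : ℕ → ℝ), IsHorizonPath 𝒟 γ ∧ Tendsto s atTop atTop ∧ IsHorizonHullElementAlong 𝒟 Λ r₀ γ s 𝓢 E p)) → (IsMinkowski 𝓢 → E.horizon = ∅) ∧ ∀ [𝓢.metric.HasLeviCivita], (𝓢.metric.IsGloballyHyperbolic 𝓢.timeOrientation ∧ 𝓢.metric.IsTimelikeGeodesicallyComplete ∧ 𝓢.metric.IsNullGeodesicallyComplete) ∨ (∃ (𝓢' : Spacetime.{0} 4) (E' : EndDatum 𝓢') (Λ' : ℕ → ℝ≥0) (r₀' : ℝ) (j : 𝓢'.carrier → 𝓢.carrier), IsTameClass E' Λ' r₀' ∧ E'.IsNonRadiating ∧ (∀ [𝓢'.metric.HasLeviCivita], 𝓢'.metric.IsGloballyHyperbolic 𝓢'.timeOrientation ∧ ((𝓢'.blackHoleRegionOfEnd (Set.range E'.far)).Nonempty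 ∨ (𝓢'.metric.IsTimelikeGeodesicallyComplete ∧ 𝓢'.metric.IsNullGeodesicallyComplete))) ∧ Function.Injective j ∧ PseudoRiemannianMetric.IsLocalIsometry 𝓢'.metric.toPseudoRiemannianMetric 𝓢.metric.toPseudoRiemannianMetric j ∧ j '' E'.doc = E.doc ∧ (IsMinkowski 𝓢' → IsMinkowski 𝓢)) := by
  intro H X _ _ _ _ _ _ D hD 𝒟 _ hdev Λ r₀ 𝓢 E p helem
  obtain ⟨hI, hC, hF⟩ := H X D hD 𝒟 hdev Λ r₀ 𝓢 E p helem
  refine ⟨fun hmink ↦ ?_, fun {inst} ↦ ?_⟩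
  · -- (G6) from (I): `𝓔⁺ ⊆ B = ∅`
    exact Set.subset_eq_empty (futureEventHorizonOfEnd_subset_blackHoleRegionOfEnd (𝓢 := 𝓢)) (hI hmink)
  · by_cases hdoc : E.doc = Set.univ
    · exact Or.inl (hF hdoc)
    · right
      obtain ⟨U, hU, hpU, hdocU, hfarU, hhorU, hballs, hGH⟩ := hC hdoc
      -- the class and silence of the element
      have hcls : IsTameClass E Λ r₀ := by
        rcases helem with ⟨q, hq⟩ | ⟨γ, s, -, -, hh⟩
        · exact hq.2.1
        · exact hh.1
      have hsil : E.IsSilent := by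
        rcases helem with ⟨q, hq⟩ | ⟨γ, s, -, -, hh⟩
        · exact hq.2.2.1
        · exact hh.2.1
      have hfar' : Set.range E.far ⊆ U := by rintro _ ⟨x, rfl⟩; exact hfarU x
      set R := 𝓢.restrict PseudoRiemannianMetric.contMDiff_restrict_holds 𝓢.timeOrientation.contMDiff_restrict_holds U hU
        with hR
      set E' : EndDatum R := ⟨E.M, E.R, E.C, fun x ↦ (⟨E.far x, hfarU x⟩ : U), fun y : U ↦ E.clock y.1⟩ with hE'
      have hcls' : IsTameClass E' Λ r₀ := by
        rw [hE']; exact isTameClass_transport hU E hfarU hdocU hcls hballs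
      have hsil' : E'.IsSilent := by
        rw [hE']; exact isSilent_transport hU E hfarU hdocU hhorU hcls.isTameEnd.clock_smooth hsil
      have hdocE' : E'.doc = Subtype.val ⁻¹' E.doc := by
        rw [hE']; exact doc_transport hU E hfarU hdocU
      have hhorE' : E'.horizon = Subtype.val ⁻¹' E.horizon := by
        rw [hE']; exact horizon_transport hU E hfarU hdocU
      have hrangeE' : Set.range E'.far = Subtype.val ⁻¹' Set.range E.far := by
        rw [hE']; exact range_far_transport E hfarU
      refine ⟨R, E', Λ, r₀, Subtype.val, hcls', hsil'.1, fun {instR} ↦ ?_, Subtype.val_injective,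
        isLocalIsometry_subtypeVal_restrict 𝓢 U hU, ?_, fun hminkR ↦ ?_⟩
      · -- global hyperbolicity and a black hole, from (C)
        obtain ⟨hgh, hbh⟩ := hGH
        refine ⟨hgh, Or.inl ?_⟩
        rw [hrangeE']; exact hbh
      · -- `j '' E'.doc = E.doc`
        rw [hdocE']
        exact Set.image_preimage_eq_of_subset fun x hx ↦ ⟨(⟨x, hdocU hx⟩ : U), rfl⟩
      · -- `IsMinkowski 𝓢|_U → IsMinkowski 𝓢`, vacuously: the trimmed element is a silent hull element with a black hole
        exfalso
        haveI : R.metric.HasLeviCivita := R.metric.toPseudoRiemannianMetric.hasLeviCivita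
        obtain ⟨-, hbh⟩ := hGH
        have helem' : (∃ q : ℕ → 𝒟.carrier, IsSilentHullElement 𝒟 Λ r₀ q R E' (Subtype.mk p hpU)) ∨
            (∃ (γ : ℝ → 𝒟.carrier) (s : ℕ → ℝ), IsHorizonPath 𝒟 γ ∧ Tendsto s atTop atTop ∧
              IsHorizonHullElementAlong 𝒟 Λ r₀ γ s R E' (Subtype.mk p hpU)) := by
          rcases helem with ⟨q, hq⟩ | ⟨γ, s, hγ, hs, hh⟩
          · refine Or.inl ⟨q, ?_⟩
            rw [hE']
            exact hq.trim_transport hU hpU hfarU hdocU hhorU hballs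
          · refine Or.inr ⟨γ, s, hγ, hs, hh.trim U hU hpU E' hcls' hsil' ?_⟩
            rw [hhorE']
            exact hh.2.2.1
        have hempty := (H X D hD 𝒟 hdev Λ r₀ R E' _ helem').1 hminkR
        have hbh' : (R.blackHoleRegionOfEnd (Set.range E'.far)).Nonempty := by
          rw [hrangeE']; exact hbh
        exact (Set.nonempty_iff_ne_empty.1 hbh') hempty

end Summit.FinalStateConjecture.FinalStateConjecture.Theorems.TameLaSalle

end
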